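import Summits.ResolutionOfSingularities.ResolutionOfSingularities.Theorems.WeightedInvariantWeightedThesisHypersurfaceChoice
import Literature.AlgebraicGeometry.Resolution.AlterationsStrong
import Literature.AlgebraicGeometry.Resolution.AlterationsNormalFormBlowup
import HarnessLib

/-!
# Hypersurface centre choices BY TRANSVERSAL DIMENSION — the choice door as a ladder

Route `ResolutionOfSingularities/WeightedInvariant`, crux `Theses.WeightedInvariant.WeightedThesis`
(stmt-ResolutionOfSingularities-0569), line `datum-glued-split`, lead c9, RESHAPE 9 — second objects file.

`HypersurfaceCentreChoice p` (`Theorems/…HypersurfaceChoice.lean`) asks for ONE centre rule good on every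
singular integral hypersurface pair of every dimension at once. Its obligations never relate two different
pairs, so they can be cut along an invariant of the TOWERS: Włodarczyk's cobordant blow-up raises the
dimension of the ambient and of the hypersurface by one and the rank of the acting torus by one, so the
transversal dimension — the dimension of the hypersurface a tower was STARTED at — is constant along every
tower. This file posits the correspondingly indexed family:

* `HypersurfacePair.ReachDim c e P` — the pair `P` is reached, along the tower-step relation of the centre
  rule `c`, from a start pair whose (integral) hypersurface has dimension `e`;
* `HypersurfaceCentreChoiceDim p e` — a centre rule with the four obligations of a choice (`(iii)` regular
  weighted centre, `(ii')` generic point off the support, `(H)` homogeneity on every torus chart of the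
  pair, `(T)` termination) demanded ONLY on the pairs reached from dimension-`e` starts (so the constructor
  knows the transversal dimension `e` and the torus rank `dim X(P) - e` of every pair it must treat, and may
  read the whole history of the pair off the reachability witness);
* `HypersurfaceCentreChoiceDim.ofChoice` — a choice is a choice in every transversal dimension (forget the
  guards); so stmt-0571 ⇒ hypersurface datum ⇒ strategy ⇒ choice ⇒ `∀ e, choice in dimension e`;
* `hyp_exists_nat_topologicalKrullDim_ker_subscheme` (registered stub of the line) — the hypersurface of a
  closed immersion from an integral scheme has a natural-number dimension (where every tower STARTS).

The consumer side (`Theorems/…HypersurfaceChoiceDimTower.lean`) runs the tower inside one reachability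
class and proves `(∀ p prime, ∀ e, Nonempty (HypersurfaceCentreChoiceDim p e)) → (char-p Bergh–Rydh) →
WeightedThesis`. The ladder: `e = 0` is vacuous (a `0`-dimensional integral hypersurface is a reduced
point, regular — `Theorems/…HypersurfaceChoiceDimZero.lean`); `e = 1` (curves on smooth surfaces, torus-
equivariantly along their cobordant towers) is the sector of Abramovich–Quek–Schober's positive results on
weighted resolution of plane curves over perfect fields; `e = 2` is the sector of Cossart–Jannsen–Saito
(embedded surfaces) made torus-equivariant; `e ≥ 3` is open (Abramovich–Temkin–Włodarczyk 2024, §1.9).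
-/

noncomputable section

open CategoryTheory AlgebraicGeometry TopologicalSpace
open Literature.AlgebraicGeometry.Resolution

set_option linter.dupNamespace false -- mandated namespace of this single-conjunct summit

namespace Summit.ResolutionOfSingularities.ResolutionOfSingularities.Theorems

/-! ## Reachability from a start of given dimension -/

namespace HypersurfacePair

variable {k : Type} [Field k]

/-- **The hypersurface pair of a closed immersion with locally principal kernel**: `(Y, ker i)` for
`i : X ⟶ Y` a closed immersion from an integral scheme (`V(ker i) ≅ X` is integral). [folklore] -/
abbrev ofKer {Y X : Scheme.{0}} (f : Y ⟶ Spec (.of k)) [Smooth f] [IsSeparated f] [QuasiCompact f]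
    (i : X ⟶ Y) [IsClosedImmersion i] [IsIntegral X] (hlp : IsLocallyPrincipal i.ker) :
    HypersurfacePair k :=
  @HypersurfacePair.mk k _ Y f inferInstance inferInstance inferInstance i.ker hlp
    (HypersurfaceTower.isIntegral_ker_subscheme i)

/-- `ofKer` has ambient `Y`. [folklore] -/
@[simp] theorem ofKer_Y {Y X : Scheme.{0}} (f : Y ⟶ Spec (.of k)) [Smooth f] [IsSeparated f]
    [QuasiCompact f] (i : X ⟶ Y) [IsClosedImmersion i] [IsIntegral X] (hlp : IsLocallyPrincipal i.ker) :
    (ofKer f i hlp).Y = Y := rfl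

/-- `ofKer` has ideal sheaf `ker i`. [folklore] -/
@[simp] theorem ofKer_X {Y X : Scheme.{0}} (f : Y ⟶ Spec (.of k)) [Smooth f] [IsSeparated f]
    [QuasiCompact f] (i : X ⟶ Y) [IsClosedImmersion i] [IsIntegral X] (hlp : IsLocallyPrincipal i.ker) :
    (ofKer f i hlp).X = i.ker := rfl

/-- **Reachability in transversal dimension `e`.** `ReachDim c e P`: the hypersurface pair `P` is reached
from some START pair `P₀` whose hypersurface `V(X(P₀))` has dimension `e`, by finitely many steps of the
tower-step relation `Step c` of the centre rule `c` (each step: `P₀`'s successor is the global cobordant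
blow-up of `c P₀` with the strict transform). Along a tower the dimension of the hypersurface and the rank
of the acting torus both grow by one per step, so `e` is the transversal dimension of every pair of the
class and `dim V(X(P)) - e` its torus rank. A predicate of the line, not a cited statement. [folklore] -/
def ReachDim (c : ∀ ⦃Y : Scheme.{0}⦄, (Y ⟶ Spec (.of k)) → Y.IdealSheafData → ReesAlgebraData Y)
    (e : ℕ) (P : HypersurfacePair k) : Prop :=
  ∃ P₀ : HypersurfacePair k, topologicalKrullDim P₀.X.subscheme = (e : WithBot ℕ∞) ∧
    Relation.ReflTransGen (fun Q Q' : HypersurfacePair k => Step c Q' Q) P₀ P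

variable {c : ∀ ⦃Y : Scheme.{0}⦄, (Y ⟶ Spec (.of k)) → Y.IdealSheafData → ReesAlgebraData Y} {e : ℕ}

/-- A start pair of dimension `e` is reached in transversal dimension `e` (the empty tower). [folklore] -/
theorem ReachDim.start {P : HypersurfacePair k}
    (hP : topologicalKrullDim P.X.subscheme = (e : WithBot ℕ∞)) : ReachDim c e P :=
  ⟨P, hP, Relation.ReflTransGen.refl⟩

/-- Reachability is inherited by tower successors. [folklore] -/
theorem ReachDim.step {P P' : HypersurfacePair k} (h : ReachDim c e P) (hs : Step c P' P) :
    ReachDim c e P' := by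
  obtain ⟨P₀, h0, hch⟩ := h
  exact ⟨P₀, h0, hch.tail hs⟩

end HypersurfacePair


/-! ## The hypersurface of a closed immersion has a natural-number dimension -/

/-- **The hypersurface of a closed immersion has a natural-number dimension** (registered stub of line
`datum-glued-split`, RESHAPE 9 — the START of the ladder): for `i : X ⟶ Y` a closed immersion from an
integral scheme into a quasi-compact `k`-scheme locally of finite type, `V(ker i)` is a non-empty scheme of
finite type over the field `k`, so `dim V(ker i) = e` for some `e : ℕ` (tree:
`exists_topologicalKrullDim_le_of_locallyOfFiniteType`, `exists_topologicalKrullDim_eq_nat`). [folklore] -/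
theorem hyp_exists_nat_topologicalKrullDim_ker_subscheme : ∀ {k : Type} [Field k] {Y X : AlgebraicGeometry.Scheme.{0}} (f : Y ⟶ AlgebraicGeometry.Spec (.of k)) [AlgebraicGeometry.LocallyOfFiniteType f] [AlgebraicGeometry.QuasiCompact f] (i : X ⟶ Y) [AlgebraicGeometry.IsClosedImmersion i] [AlgebraicGeometry.IsIntegral X], ∃ e : ℕ, topologicalKrullDim ↥(AlgebraicGeometry.Scheme.Hom.ker i).subscheme = (e : WithBot ℕ∞) := by
  intro k _ Y X f _ _ i _ _
  haveI : IsIntegral i.ker.subscheme := HypersurfaceTower.isIntegral_ker_subscheme i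
  haveI : QuasiCompact (i.ker.subschemeι ≫ f) := inferInstance
  haveI : CompactSpace i.ker.subscheme :=
    QuasiCompact.compactSpace_of_compactSpace (i.ker.subschemeι ≫ f)
  obtain ⟨d, hd⟩ := exists_topologicalKrullDim_le_of_locallyOfFiniteType (i.ker.subschemeι ≫ f)
  exact exists_topologicalKrullDim_eq_nat hd

/-! ## Hypersurface centre choices in transversal dimension `e` -/

/-- **Hypersurface centre choice in characteristic `p` and transversal dimension `e`** (object posited by
line `datum-glued-split` of crux `WeightedThesis`, RESHAPE 9 — the choice door as a ladder): a total centre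
rule `centre f X : ReesAlgebraData Y` such that, over every perfect field `k` of characteristic `p`, on
every hypersurface pair `P` REACHED IN TRANSVERSAL DIMENSION `e` along the towers of `centre`
(`HypersurfacePair.ReachDim`) whose hypersurface is NOT regular: `(iii)` the centre is a regular weighted
centre, `(ii')` the generic point of the hypersurface is off its support (pairs presented by a closed
immersion `i`, `HypersurfacePair.ofKer`), `(H)` every piece of the centre is homogeneous for every
`ℤʲ`-grading of every affine open of the ambient with the constants in degree `0` and the hypersurface
ideal homogeneous, and `(T)` the tower-step relation restricted to the pairs reached in transversal
dimension `e` is well-founded. The obligations of `HypersurfaceCentreChoice p` cut down to one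
transversal dimension; every choice is one in every dimension (`HypersurfaceCentreChoiceDim.ofChoice`).
Shape: weighted embedded resolution of `e`-dimensional hypersurfaces, torus-equivariant along its own
cobordant towers (`e = 1`: the sector of Abramovich–Quek–Schober's weighted resolution of plane curves
over perfect fields; all `e`: Abramovich–Temkin–Włodarczyk 2024 Thm. 1.1.1 in characteristic `0`, §1.9 in
characteristic `p`). EVIDENCE, not a claim. -/
structure HypersurfaceCentreChoiceDim (p e : ℕ) : Type 1 where
  /-- the weighted centre of `(Y, X)`, as a Rees algebra on `Y` (total) -/
  centre : ∀ ⦃k : Type⦄ [Field k] ⦃Y : Scheme.{0}⦄, (Y ⟶ Spec (.of k)) → Y.IdealSheafData →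
    ReesAlgebraData Y
  /-- `(iii)` [singular pairs reached in transversal dimension `e`] the centre is a regular weighted
  centre -/
  isRegularWeightedCentre_centre : ∀ ⦃k : Type⦄ [Field k] [CharP k p] [PerfectField k]
    (P : HypersurfacePair k),
    HypersurfacePair.ReachDim (fun ⦃Y : Scheme.{0}⦄ (f : Y ⟶ Spec (.of k)) X => centre f X) e P →
    ¬ Scheme.IsRegular P.X.subscheme → (centre P.f P.X).IsRegularWeightedCentre
  /-- `(ii')` [singular pairs reached in transversal dimension `e`, presented by a closed immersion `i`]
  the generic point of the hypersurface is off the centre -/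
  genericPoint_not_mem_support_centre : ∀ ⦃k : Type⦄ [Field k] [CharP k p] [PerfectField k]
    ⦃Y X : Scheme.{0}⦄ (f : Y ⟶ Spec (.of k)) [Smooth f] [IsSeparated f] [QuasiCompact f]
    (i : X ⟶ Y) [IsClosedImmersion i] [IsIntegral X] (hlp : IsLocallyPrincipal i.ker),
    HypersurfacePair.ReachDim (fun ⦃Y : Scheme.{0}⦄ (f : Y ⟶ Spec (.of k)) X => centre f X) e
      (HypersurfacePair.ofKer f i hlp) →
    ¬ Scheme.IsRegular X → i (genericPoint X) ∉ (centre f i.ker).support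
  /-- `(H)` [singular pairs reached in transversal dimension `e`] the centre is homogeneous on every
  torus chart of the pair -/
  centre_isHomogeneous : ∀ ⦃k : Type⦄ [Field k] [CharP k p] [PerfectField k]
    (P : HypersurfacePair k),
    HypersurfacePair.ReachDim (fun ⦃Y : Scheme.{0}⦄ (f : Y ⟶ Spec (.of k)) X => centre f X) e P →
    ¬ Scheme.IsRegular P.X.subscheme →
    ∀ ⦃j : ℕ⦄ (W : P.Y.affineOpens) (𝒢 : (Fin j → ℤ) → AddSubgroup Γ(P.Y, W)) [GradedRing 𝒢],
    (∀ c : Γ(Spec (.of k), ⊤), P.f.appLE ⊤ W le_top c ∈ 𝒢 0) → (P.X.ideal W).IsHomogeneous 𝒢 →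
    ∀ n : ℕ, (((centre P.f P.X).piece n).ideal W).IsHomogeneous 𝒢
  /-- `(T)` over every perfect field of characteristic `p`, every cobordant tower started in dimension
  `e` stops: the tower-step relation restricted to the pairs reached in transversal dimension `e` is
  well-founded -/
  wellFounded_step : ∀ ⦃k : Type⦄ [Field k] [CharP k p] [PerfectField k],
    WellFounded fun P' P : HypersurfacePair k =>
      HypersurfacePair.ReachDim (fun ⦃Y : Scheme.{0}⦄ (f : Y ⟶ Spec (.of k)) X => centre f X) e P ∧
      HypersurfacePair.Step (fun ⦃Y : Scheme.{0}⦄ (f : Y ⟶ Spec (.of k)) X => centre f X) P' P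

namespace HypersurfaceCentreChoiceDim

variable {p : ℕ}

/-- **Every hypersurface centre choice is a choice in every transversal dimension** (forget the
reachability guards; `(T)` by restriction of the well-founded tower-step relation). [folklore] -/
def ofChoice (C : HypersurfaceCentreChoice p) (e : ℕ) : HypersurfaceCentreChoiceDim p e where
  centre := C.centre
  isRegularWeightedCentre_centre := fun _ _ _ _ P _ hsing => by
    obtain ⟨Y, f, X, hX, hXi⟩ := P
    exact C.isRegularWeightedCentre_centre f X hX hXi hsing
  genericPoint_not_mem_support_centre := fun _ _ _ _ _ _ f _ _ _ i _ _ hlp _ hsing =>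
    C.genericPoint_not_mem_support_centre f i hlp hsing
  centre_isHomogeneous := fun _ _ _ _ P _ hsing j W 𝒢 _ h0 hXhom n => by
    obtain ⟨Y, f, X, hX, hXi⟩ := P
    exact C.centre_isHomogeneous f X hX hXi hsing W 𝒢 h0 hXhom n
  wellFounded_step := fun k _ _ _ =>
    Subrelation.wf (fun h => h.2) (C.wellFounded_step (k := k))

/-- `ofChoice` keeps the centre. [folklore] -/
@[simp] theorem ofChoice_centre (C : HypersurfaceCentreChoice p) (e : ℕ) :
    (ofChoice C e).centre = C.centre := rfl

/-- **Choice ⇒ choice in every transversal dimension.** [folklore] -/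
theorem nonempty_of_nonempty_choice (h : Nonempty (HypersurfaceCentreChoice p)) (e : ℕ) :
    Nonempty (HypersurfaceCentreChoiceDim p e) :=
  h.map fun C => ofChoice C e

/-- **Strategy ⇒ choice in every transversal dimension.** [folklore] -/
theorem nonempty_of_nonempty_strategy (h : Nonempty (HypersurfaceCentreStrategy p)) (e : ℕ) :
    Nonempty (HypersurfaceCentreChoiceDim p e) :=
  nonempty_of_nonempty_choice (HypersurfaceCentreChoice.nonempty_of_nonempty_strategy h) e

/-- **`WeightedConstruction` (stmt-0571) ⇒ choice in every transversal dimension**, prime by prime.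
[folklore] -/
theorem nonempty_of_nonempty_datum (h : Nonempty (WeightedResolutionDatum p)) (e : ℕ) :
    Nonempty (HypersurfaceCentreChoiceDim p e) :=
  nonempty_of_nonempty_choice (HypersurfaceCentreChoice.nonempty_of_nonempty_datum h) e

end HypersurfaceCentreChoiceDim

/-- **Registered form `hyp_nonempty_choiceDim_of_hypersurfaceChoice`** (registered stub of line
`datum-glued-split`, RESHAPE 9): a hypersurface centre choice in characteristic `p` is a choice in every
transversal dimension — so the one-piece door implies every rung of the ladder. [folklore] -/
theorem hyp_nonempty_choiceDim_of_hypersurfaceChoice : ∀ {p : ℕ}, Summit.ResolutionOfSingularities.ResolutionOfSingularities.Theorems.HypersurfaceCentreChoice p → ∀ e : ℕ, Nonempty (Summit.ResolutionOfSingularities.ResolutionOfSingularities.Theorems.HypersurfaceCentreChoiceDim p e) :=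
  fun C e => ⟨HypersurfaceCentreChoiceDim.ofChoice C e⟩

end Summit.ResolutionOfSingularities.ResolutionOfSingularities.Theorems

end
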